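import Literature.AnabelianGeometry.SemiGraphs.TemperedEstrangedElevatedConstructors
import Literature.AnabelianGeometry.SemiGraphs.ThetaRayGraph
import Mathlib.NumberTheory.Padics.RingHoms
import HarnessLib

/-!
# (H6) for the ray of groups `𝒢_θ`: totally elevated — by ABELIAN approximators, without Lazard

S. Mochizuki, *Semi-graphs of anabelioids*, Publ. RIMS **42** (2006), Def. 2.3 (i)–(ii) pp. 24–25
(approximators, `π₁`-epimorphic) and Def. 2.4 (i) p. 25 («elevated»: «for every integer `M ≥ 1`, there exists a
`π₁`-epimorphic approximator `𝒢 → 𝒢'` … a subgroup `N_M ⊆ π̂₁(𝒢'_v)` of order `≥ M` which has trivial intersection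
with all of the conjugates, in `π̂₁(𝒢'_v)`, of all of the `π̂₁(𝒢'_e)`»), for `𝒢_θ = thetaRay G E up low` of
`ThetaRayGraph.lean` (brick R3).

`thetaRay_isTotallyElevated` — BINDER FORM over the vertex/edge groups: if `G` carries a continuous
SURJECTIVE homomorphism `ab : G → ℤ_p × ℤ_p` and `E` a continuous surjective `εE : E → ℤ_p` through which the
gluings read `ab (up t) = (εE t, 0)` and `ab (low k t) = (εE t, c_k · εE t)` (`c_k = p^{n_k}` for the memo's
`𝒢_θ`; ANY `c : ℕ → ℤ_p` works), then every vertex is elevated: at level `p^s` (`s := M`) the approximator with ALL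
vertex groups `(ℤ/p^s)²` (via `ab` mod `p^s`), edge groups `ℤ/p^s`, branch maps `x ↦ (x, 0)` / `x ↦ (x, c̄_k x)`
is `π₁`-epimorphic with open kernels and injective branch maps, and `N := 0 × ℤ/p^s` (order `p^s ≥ M`) meets
every branch image trivially; conjugates are invisible in the abelian `(ℤ/p^s)²`
(`isTotallyElevated_of_comm_approximators`).  Print p. 25 quantifies over ANY `π₁`-epimorphic approximator, so
no lower-`p`-central / Lazard–Witt layer count is needed.  The approximator is built INSIDE the proof (this file
declares no definition).

Cell context (abc-iut, layer L3, FRONTIER programme SUBDAG-REFUTE-F1732, brick R5 (H6), seat abc-iut-w6-d102):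
this is the binder `hTE` of `thetaRay_prop36Hypotheses` / `thetaRay_thm37Hypotheses`
(`ThetaRayGraphHypotheses.lean`); the inputs `ab`, `εE`, `c`, `hα`, `hβ` are brick R1's data (free pro-`p`
group of rank two: `ab(a) = (1,0)`, `ab(b) = (0,1)`, `α(1) = a`, `θ_m(a) = a·b^{p^m}`).  Towards a kernel erratum
for the ∀-countable reading of [SemiAnbd] Thm 3.7 (iii) ([IUTchI] Rmk 2.5.3); desk countermodel abc-iut-L3-d1
g3 (memo 8b26b5199c29f55f); print proves finite `𝔾` (kernel: p431007).  PROOF-ONLY, no definition, no named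
fact; nothing here bears on [IUTchIII] Cor. 3.12; typed ≠ proved. [cite: MochizukiSemiAnbd2006, Def 2.4(i) p.25]
-/

noncomputable section

namespace Literature.AnabelianGeometry.SemiGraphs

namespace ProfiniteSemiGraph

open Topology

section H6

variable {G E : Type} [Group G] [TopologicalSpace G] [IsTopologicalGroup G] [CompactSpace G]
  [TotallyDisconnectedSpace G] [Group E] [TopologicalSpace E] [IsTopologicalGroup E] [CompactSpace E]
  [TotallyDisconnectedSpace E] (α : E →ₜ* G) (β : ℕ → (E →ₜ* G))

variable (p : ℕ) [Fact p.Prime]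

/-- The fibres of reduction mod `p^s`, `ℤ_p → ℤ/p^s`, are open (closed balls of radius `p^{-s}`).
[folklore] -/
private theorem isOpen_fiber_toZModPow (s : ℕ) (r : ZMod (p ^ s)) :
    IsOpen ((PadicInt.toZModPow s : ℤ_[p] → ZMod (p ^ s)) ⁻¹' {r}) := by
  rw [isOpen_iff_mem_nhds]
  intro x hx
  have hx' : PadicInt.toZModPow s x = r := hx
  have hpos : (0 : ℝ) < (p : ℝ) ^ (-(s : ℤ)) :=
    zpow_pos (by exact_mod_cast (Fact.out : p.Prime).pos) _
  refine Filter.mem_of_superset (Metric.ball_mem_nhds x hpos) fun y hy => ?_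
  change PadicInt.toZModPow s y ∈ ({r} : Set (ZMod (p ^ s)))
  rw [Set.mem_singleton_iff, ← hx', ← sub_eq_zero, ← map_sub, ← RingHom.mem_ker,
    PadicInt.ker_toZModPow, ← PadicInt.norm_le_pow_iff_mem_span_pow, ← dist_eq_norm]
  exact (Metric.mem_ball.mp hy).le

/-- Reduction mod `p^s` is surjective. [folklore] -/
private theorem toZModPow_surjective (s : ℕ) :
    Function.Surjective (PadicInt.toZModPow s : ℤ_[p] → ZMod (p ^ s)) := by
  haveI : NeZero (p ^ s) := ⟨pow_ne_zero _ (Fact.out : p.Prime).ne_zero⟩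
  intro r
  refine ⟨(r.val : ℤ_[p]), ?_⟩
  rw [map_natCast, ZMod.natCast_zmod_val]

/-- **(H6) in binder form**: if the vertex group carries a continuous surjection
`ab : G → ℤ_p × ℤ_p` and the edge group a continuous surjection `εE : E → ℤ_p` such that the upper gluing
`α` reads `t ↦ (t, 0)` and the lower gluings `β k` read `t ↦ (t, c_k · t)` through them, then EVERY vertex of
the ray of groups is elevated: at level `p^s` the approximator with ALL vertex groups `(ℤ/p^s)²`, edge groups
`ℤ/p^s`, branch maps `x ↦ (x, 0)` / `x ↦ (x, c̄_k x)` is `π₁`-epimorphic, and `N = 0 × ℤ/p^s` (order `p^s`)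
meets every branch image trivially — conjugates being irrelevant in an abelian group (no Lazard layer count).
[cite: MochizukiSemiAnbd2006, Def 2.4(i) p.25] -/
theorem thetaRay_isTotallyElevated
    (ab : G →* Multiplicative (ℤ_[p] × ℤ_[p])) (hab : Continuous ab) (hab_surj : Function.Surjective ab)
    (εE : E →* Multiplicative ℤ_[p]) (hε : Continuous εE) (hε_surj : Function.Surjective εE)
    (c : ℕ → ℤ_[p])
    (hα : ∀ t : E, ab (α t) = Multiplicative.ofAdd (Multiplicative.toAdd (εE t), 0))
    (hβ : ∀ (k : ℕ) (t : E), ab (β k t) =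
      Multiplicative.ofAdd (Multiplicative.toAdd (εE t), c k * Multiplicative.toAdd (εE t))) :
    (thetaRay G E α β).IsTotallyElevated := by
  refine (thetaRay G E α β).isTotallyElevated_of_comm_approximators fun v M => ?_
  -- the level `s := M`
  set s : ℕ := M with hs
  haveI hq : NeZero (p ^ s) := ⟨pow_ne_zero _ (Fact.out : p.Prime).ne_zero⟩
  -- the reductions
  let red : ℤ_[p] →+ ZMod (p ^ s) := (PadicInt.toZModPow s : ℤ_[p] →+* ZMod (p ^ s)).toAddMonoidHom
  let redV : Multiplicative (ℤ_[p] × ℤ_[p]) →* Multiplicative (ZMod (p ^ s) × ZMod (p ^ s)) :=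
    (AddMonoidHom.prodMap red red).toMultiplicative
  let redE : Multiplicative ℤ_[p] →* Multiplicative (ZMod (p ^ s)) := red.toMultiplicative
  -- the level coefficients of the branches: `0` at upper ends, `c̄_k` at lower ends
  let cb : ℕ × Bool → ZMod (p ^ s) := fun b => if b.2 then 0 else PadicInt.toZModPow s (c b.1)
  let gr : ZMod (p ^ s) → (Multiplicative (ZMod (p ^ s)) →* Multiplicative (ZMod (p ^ s) × ZMod (p ^ s))) :=
    fun d => ((AddMonoidHom.id (ZMod (p ^ s))).prod (AddMonoidHom.mulLeft d)).toMultiplicative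
  -- continuity facts
  have hred_open : ∀ r : ZMod (p ^ s), IsOpen ((fun x : ℤ_[p] => PadicInt.toZModPow s x) ⁻¹' {r}) :=
    isOpen_fiber_toZModPow p s
  have hkerV : IsOpen (((redV.comp ab).ker : Subgroup G) : Set G) := by
    have h1 : Continuous fun g : G => (Multiplicative.toAdd (ab g)).1 :=
      continuous_fst.comp (continuous_toAdd.comp hab)
    have h2 : Continuous fun g : G => (Multiplicative.toAdd (ab g)).2 :=
      continuous_snd.comp (continuous_toAdd.comp hab)
    have hset : (((redV.comp ab).ker : Subgroup G) : Set G) =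
        (fun g : G => (Multiplicative.toAdd (ab g)).1) ⁻¹'
            ((fun x : ℤ_[p] => PadicInt.toZModPow s x) ⁻¹' {0}) ∩
          (fun g : G => (Multiplicative.toAdd (ab g)).2) ⁻¹'
            ((fun x : ℤ_[p] => PadicInt.toZModPow s x) ⁻¹' {0}) := by
      ext g
      simp only [SetLike.mem_coe, MonoidHom.mem_ker, Set.mem_inter_iff, Set.mem_preimage,
        Set.mem_singleton_iff]
      constructor
      · intro h
        have h' := congrArg Multiplicative.toAdd h
        exact ⟨congrArg Prod.fst h', congrArg Prod.snd h'⟩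
      · rintro ⟨h1', h2'⟩
        apply Multiplicative.toAdd.injective
        exact Prod.ext h1' h2'
    rw [hset]
    exact ((hred_open 0).preimage h1).inter ((hred_open 0).preimage h2)
  have hkerE : IsOpen (((redE.comp εE).ker : Subgroup E) : Set E) := by
    have h1 : Continuous fun g : E => Multiplicative.toAdd (εE g) := continuous_toAdd.comp hε
    have hset : (((redE.comp εE).ker : Subgroup E) : Set E) =
        (fun g : E => Multiplicative.toAdd (εE g)) ⁻¹' ((fun x : ℤ_[p] => PadicInt.toZModPow s x) ⁻¹' {0}) := by
      ext g
      simp only [SetLike.mem_coe, MonoidHom.mem_ker, Set.mem_preimage, Set.mem_singleton_iff]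
      constructor
      · intro h; exact congrArg Multiplicative.toAdd h
      · intro h; exact Multiplicative.toAdd.injective h
    rw [hset]
    exact (hred_open 0).preimage h1
  haveI hfinV : Finite (Multiplicative (ZMod (p ^ s) × ZMod (p ^ s))) :=
    Finite.of_equiv (ZMod (p ^ s) × ZMod (p ^ s)) Multiplicative.ofAdd
  haveI hfinE : Finite (Multiplicative (ZMod (p ^ s))) := Finite.of_equiv (ZMod (p ^ s)) Multiplicative.ofAdd
  -- `comm` for the two kinds of branches
  have hcomm : ∀ (b : ℕ × Bool) (v : ℕ) (h : SemiGraph.ray.abuts b = some v) (x : E),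
      gr (cb b) (redE (εE x)) = redV (ab ((thetaRay G E α β).brHom b v h x)) := by
    rintro ⟨k, sb⟩ v h x
    apply Multiplicative.toAdd.injective
    cases sb
    · -- lower end: `brHom = β k`, `ab (β k x) = (t, c_k t)`
      show Multiplicative.toAdd (gr (cb (k, false)) (redE (εE x))) = Multiplicative.toAdd (redV (ab (β k x)))
      rw [hβ]
      show ((red (Multiplicative.toAdd (εE x)), cb (k, false) * red (Multiplicative.toAdd (εE x))) :
          ZMod (p ^ s) × ZMod (p ^ s)) =
        (red (Multiplicative.toAdd (εE x)), red (c k * Multiplicative.toAdd (εE x)))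
      refine Prod.ext rfl ?_
      show PadicInt.toZModPow s (c k) * PadicInt.toZModPow s (Multiplicative.toAdd (εE x)) =
        PadicInt.toZModPow s (c k * Multiplicative.toAdd (εE x))
      rw [map_mul]
    · -- upper end: `brHom = α`, `ab (α x) = (t, 0)`
      show Multiplicative.toAdd (gr (cb (k, true)) (redE (εE x))) = Multiplicative.toAdd (redV (ab (α x)))
      rw [hα]
      show ((red (Multiplicative.toAdd (εE x)), (0 : ZMod (p ^ s)) * red (Multiplicative.toAdd (εE x))) :
          ZMod (p ^ s) × ZMod (p ^ s)) =
        (red (Multiplicative.toAdd (εE x)), red 0)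
      rw [zero_mul, map_zero]
  -- the level-`p^s` approximator (built inline: this file declares no definition)
  refine ⟨{ FV := fun _ => Multiplicative (ZMod (p ^ s) × ZMod (p ^ s))
            FE := fun _ => Multiplicative (ZMod (p ^ s))
            πV := fun _ => redV.comp ab
            πE := fun _ => redE.comp εE
            isOpen_ker_πV := fun _ => hkerV
            isOpen_ker_πE := fun _ => hkerE
            brF := fun b _ _ => gr (cb b)
            brF_injective := fun b _ _ x y hxy => by
              apply Multiplicative.toAdd.injective
              exact congrArg Prod.fst (congrArg Multiplicative.toAdd hxy)
            comm := fun b v h => ⟨1, fun x => by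
              rw [one_mul, inv_one, mul_one]
              exact hcomm b v h x⟩
            bounded := ⟨Nat.card (Multiplicative (ZMod (p ^ s) × ZMod (p ^ s))), Nat.card_pos,
              fun _ => dvd_rfl⟩ },
    ⟨fun _ => ?_, fun _ => ?_⟩, fun x y => mul_comm x y,
    (AddMonoidHom.inr (ZMod (p ^ s)) (ZMod (p ^ s))).range.toSubgroup, ?_, ?_⟩
  · -- `πV` surjective
    intro z
    obtain ⟨x1, hx1⟩ := toZModPow_surjective p s (Multiplicative.toAdd z).1
    obtain ⟨x2, hx2⟩ := toZModPow_surjective p s (Multiplicative.toAdd z).2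
    obtain ⟨g, hg⟩ := hab_surj (Multiplicative.ofAdd (x1, x2))
    refine ⟨g, ?_⟩
    apply Multiplicative.toAdd.injective
    show Multiplicative.toAdd (redV (ab g)) = _
    rw [hg]
    exact Prod.ext hx1 hx2
  · -- `πE` surjective
    intro z
    obtain ⟨x1, hx1⟩ := toZModPow_surjective p s (Multiplicative.toAdd z)
    obtain ⟨g, hg⟩ := hε_surj (Multiplicative.ofAdd x1)
    refine ⟨g, ?_⟩
    apply Multiplicative.toAdd.injective
    show Multiplicative.toAdd (redE (εE g)) = _
    rw [hg]
    exact hx1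
  · -- `|N| = p^s ≥ s = M`
    rw [card_inr_range_zmod]
    exact (Nat.lt_pow_self (Fact.out : p.Prime).one_lt).le
  · -- `N ∩ (branch image) = ⊥` for every branch at `v`
    intro b hb
    show (AddMonoidHom.inr (ZMod (p ^ s)) (ZMod (p ^ s))).range.toSubgroup ⊓ (gr (cb b)).range = ⊥
    rw [MonoidHom.coe_toMultiplicative_range]
    exact inr_range_inf_graph_range_eq_bot (cb b)

end H6

/-! ### Discharging the surjectivity binders from generator values (for brick R1's `ab a = (1,0)`, `ab b = (0,1)`) -/

section Surjective

variable {G : Type*} [Group G] [TopologicalSpace G] [CompactSpace G]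
variable (p : ℕ) [Fact p.Prime]

/-- **A continuous homomorphism from a compact group to `ℤ_p × ℤ_p` hitting `(1,0)` and `(0,1)` is surjective**:
its image is compact, hence closed, and contains the dense lattice `ℤ × ℤ`.  (Discharges `hab_surj` of
`thetaRay_isTotallyElevated` from brick R1's `ab_a`, `ab_b`.) [cite: MochizukiSemiAnbd2006, Def 2.3(ii) p.25] -/
theorem surjective_of_ofAdd_one_zero_mem_of_ofAdd_zero_one_mem (f : G →* Multiplicative (ℤ_[p] × ℤ_[p]))
    (hf : Continuous f) (h10 : Multiplicative.ofAdd ((1 : ℤ_[p]), (0 : ℤ_[p])) ∈ f.range)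
    (h01 : Multiplicative.ofAdd ((0 : ℤ_[p]), (1 : ℤ_[p])) ∈ f.range) : Function.Surjective f := by
  -- the image is closed
  have hclosed : IsClosed (Set.range f) := (isCompact_range hf).isClosed
  -- and contains the image of the dense map `ℤ × ℤ → ℤ_p × ℤ_p`
  have hdense : DenseRange (fun nm : ℤ × ℤ => Multiplicative.ofAdd (((nm.1 : ℤ_[p])), ((nm.2 : ℤ_[p])))) := by
    have h := (PadicInt.denseRange_intCast (p := p)).prodMap (PadicInt.denseRange_intCast (p := p))
    have : (fun nm : ℤ × ℤ => Multiplicative.ofAdd (((nm.1 : ℤ_[p])), ((nm.2 : ℤ_[p])))) =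
        Multiplicative.ofAdd ∘ Prod.map (Int.cast : ℤ → ℤ_[p]) (Int.cast : ℤ → ℤ_[p]) := by
      funext nm; rfl
    rw [this]
    exact Multiplicative.ofAdd.surjective.denseRange.comp h continuous_ofAdd
  have hsub : Set.range (fun nm : ℤ × ℤ => Multiplicative.ofAdd (((nm.1 : ℤ_[p])), ((nm.2 : ℤ_[p])))) ⊆
      Set.range f := by
    rintro _ ⟨⟨n, m⟩, rfl⟩
    have hmem : Multiplicative.ofAdd ((1 : ℤ_[p]), (0 : ℤ_[p])) ^ n * Multiplicative.ofAdd ((0 : ℤ_[p]), (1 : ℤ_[p])) ^ m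
        ∈ f.range := f.range.mul_mem (f.range.zpow_mem h10 n) (f.range.zpow_mem h01 m)
    have heq : Multiplicative.ofAdd ((1 : ℤ_[p]), (0 : ℤ_[p])) ^ n * Multiplicative.ofAdd ((0 : ℤ_[p]), (1 : ℤ_[p])) ^ m
        = Multiplicative.ofAdd (((n : ℤ_[p])), ((m : ℤ_[p]))) := by
      apply Multiplicative.toAdd.injective
      rw [toAdd_mul, toAdd_zpow, toAdd_zpow, toAdd_ofAdd, toAdd_ofAdd, toAdd_ofAdd]
      ext <;> simp
    show Multiplicative.ofAdd (((n : ℤ_[p])), ((m : ℤ_[p]))) ∈ Set.range f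
    rw [← heq]
    exact hmem
  intro z
  have hz : z ∈ closure (Set.range (fun nm : ℤ × ℤ =>
      Multiplicative.ofAdd (((nm.1 : ℤ_[p])), ((nm.2 : ℤ_[p]))))) := hdense.closure_eq ▸ Set.mem_univ z
  have hz' : z ∈ Set.range f := (closure_minimal hsub hclosed) hz
  exact hz'

end Surjective

/-! ### The memo's shape with twists `low k = θ_{n_k} ∘ α` -/

section Twists

variable {G E : Type} [Group G] [TopologicalSpace G] [IsTopologicalGroup G] [CompactSpace G]
  [TotallyDisconnectedSpace G] [Group E] [TopologicalSpace E] [IsTopologicalGroup E] [CompactSpace E]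
  [TotallyDisconnectedSpace E] (α : E →ₜ* G) (θ : ℕ → (G →ₜ* G)) (n : ℕ → ℕ)
variable (p : ℕ) [Fact p.Prime]

/-- **(H6) for `thetaRayOfTwists G E α θ n`**: with `ab ∘ α = (εE, 0)` and `ab ∘ θ_{n_k} ∘ α = (εE, c_k·εE)`
(brick R1: `c_k = p^{n_k}`), every vertex is elevated. [cite: MochizukiSemiAnbd2006, Def 2.4(i) p.25] -/
theorem thetaRayOfTwists_isTotallyElevated
    (ab : G →* Multiplicative (ℤ_[p] × ℤ_[p])) (hab : Continuous ab) (hab_surj : Function.Surjective ab)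
    (εE : E →* Multiplicative ℤ_[p]) (hε : Continuous εE) (hε_surj : Function.Surjective εE)
    (c : ℕ → ℤ_[p])
    (hα : ∀ t : E, ab (α t) = Multiplicative.ofAdd (Multiplicative.toAdd (εE t), 0))
    (hθ : ∀ (k : ℕ) (t : E), ab (θ (n k) (α t)) =
      Multiplicative.ofAdd (Multiplicative.toAdd (εE t), c k * Multiplicative.toAdd (εE t))) :
    (thetaRayOfTwists G E α θ n).IsTotallyElevated :=
  thetaRay_isTotallyElevated α (fun k => (θ (n k)).comp α) p ab hab hab_surj εE hε hε_surj c hα hθ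

end Twists

end ProfiniteSemiGraph

end Literature.AnabelianGeometry.SemiGraphs

end
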